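import Literature.NumberTheory.IwasawaTheory.WeakLeopoldtCyclotomicLevels
import Literature.NumberTheory.GaloisRepresentations.LocalKummerTorsion
import Literature.NumberTheory.GaloisRepresentations.AbsGaloisGroupCompact
import Literature.NumberTheory.IwasawaTheory.Greenberg2006.TwistDeformationLEO
import HarnessLib

/-!
# Weak Leopoldt for the cyclotomic tower, assembly III: two cocycle-free bricks of the
# finite-level killing statement «stagesDie» (NSW (10.3.25), proof)

Topic `NumberTheory/IwasawaTheory`; namespace `Literature.NumberTheory.IwasawaTheory`.  Theorems only
(no definition, no named fact, no instance; D-0026).  Sequel of `WeakLeopoldtCyclotomicLevels.lean` /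
`WeakLeopoldtCyclotomicAssembly.lean` (width seat `bsd-line-x1-p1-w2` gen 8, cell `bsd-eis`, D-0154
(2) INPUTS lane for the named fact `weakLeopoldt_H2_subsingleton_cyclotomic_of_isOpen`).

The adapter «(A) Brauer killing on a cyclotomic layer + (B) `ker(inf²)` dies under
`μ_{p^a} ↪ μ_{p^{a+t}}` ⟹ stagesDie» needs, besides the cohomological theorems (A)
(`GaloisCohomology.exists_forall_resSub_mu_primePow_eq_zero_of_le_layerSubgroup`) and (B)
(`GaloisRepresentations.exists_twoCoboundary_stage_of_resSub_inflation_eq_zero`), two pieces of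
bookkeeping with no cocycles in them:

* §1 **`exists_forall_ker_modNCyclotomicCharacter_le_layerSubgroup`** — the cyclotomic LEVELS
  `F_k = ker χ̄_{p^k} = Gal(K̄/K(μ_{p^k}))` eventually lie inside every LAYER subgroup
  `κ⁻¹(p^M ℤ_p) = Gal(K̄/K_M)` of a cyclotomic `ℤ_p`-extension `κ` (`K_M ⊆ K(μ_{p^{k}})` for `k ≫ M`):
  `⋂ₖ F_k ≤ ker κ ≤ κ⁻¹(p^M ℤ_p)`, the `F_k` are closed and decreasing, `κ⁻¹(p^M ℤ_p)` is open and
  `Γ_K` is compact.  (So the output «`T ≤ κ.layerSubgroup M`» of (A) is met by a deeper STAGE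
  `T = U₀ ⊓ F_{k'}` of the «stagesDie» tower, `exists_forall_inf_ker_modNCyclotomicCharacter_le_layerSubgroup`.)
* §2 **`exists_muCarrier_embedding_extension`** — the COEFFICIENT side: for `D ≃+ ℚ_p/ℤ_p` and a
  subgroup `A ≤ D` killed by `p^a` there is an injective `e : A →+ μ_{p^a}(K̄)` (`MuCarrier K (p^a)`)
  such that, for every `t`, some `g : μ_{p^{a+t}}(K̄) →+ D` satisfies `g ∘ (μ_{p^a} ↪ μ_{p^{a+t}}) ∘ e = (A ↪ D)`
  (Prüfer embedding `ℚ_p/ℤ_p ↪ K̄ˣ` of the tree, `QpModZp.exists_injective_units`, and Baer's criterion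
  for the divisible group `ℚ_p/ℤ_p`).  (So an `A`-valued stage cocycle is read in `μ_{p^a}` — trivial
  action at stages `k ≥ a` —, (B) enlarges the coefficients to `μ_{p^{a+t}}`, and `g` reads the
  resulting coboundary back in `D`, as «stagesDie» asks.)

HONEST FRAMING: bookkeeping lemmas; no case of weak Leopoldt is proved here.

References: [NeukirchSchmidtWingberg2008] (10.3.25) (proof); [Washington1997] §13.1;
[Hungerford1974] Ch. I §3 Exercise 7, Ch. IV §3 (divisible groups are injective);
[SerreGaloisCohomology1997] I §2.2.
-/

noncomputable section

open scoped Classical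
open NumberField IsDedekindDomain Field
open Literature.NumberTheory.GaloisRepresentations
open Literature.NumberTheory.GaloisRepresentations.DiscreteGaloisModule
open Literature.NumberTheory.EllipticCurves (ZpExtension)

namespace Literature.NumberTheory.IwasawaTheory

/-! ### §1. The levels `F_k` eventually lie inside every layer subgroup of `κ^{cyc}` -/

section Levels

variable {K : Type} [Field K] [CharZero K] (p : ℕ) [hp : Fact p.Prime]

/-- **`F_k ≤ κ⁻¹(p^M ℤ_p)` for all large `k`** (`κ` cyclotomic): `K_M ⊆ K(μ_{p^k})` for `k ≫ M`.
Compactness of `Γ_K`: the closed decreasing `F_k = ker χ̄_{p^k}` have `⋂ₖ F_k ≤ ker κ ≤ κ⁻¹(p^M ℤ_p)`,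
an open subgroup. [cite: Washington1997, §13.1] [cite: NeukirchSchmidtWingberg2008, (10.3.25) (proof)] -/
theorem exists_forall_ker_modNCyclotomicCharacter_le_layerSubgroup {κ : ZpExtension K p}
    (hκ : κ.IsCyclotomic) (M : ℕ) :
    ∃ k₀ : ℕ, ∀ k : ℕ, k₀ ≤ k → (modNCyclotomicCharacter K (p ^ k)).ker ≤ κ.layerSubgroup M := by
  haveI : CompactSpace (absoluteGaloisGroup K) := absoluteGaloisGroup_compactSpace K
  set F : ℕ → Subgroup (absoluteGaloisGroup K) := fun k ↦ (modNCyclotomicCharacter K (p ^ k)).ker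
    with hF
  set O : Set (absoluteGaloisGroup K) := (κ.layerSubgroup M : Set (absoluteGaloisGroup K)) with hO
  have hOo : IsOpen O := κ.isOpen_layerSubgroup M
  have hsub : ((⨅ k, F k : Subgroup (absoluteGaloisGroup K)) : Set (absoluteGaloisGroup K)) ⊆ O :=
    fun x hx ↦ κ.kerSubgroup_le_layerSubgroup M
      (iInf_ker_modNCyclotomicCharacter_le_kerSubgroup p hκ hx)
  have hcpt : IsCompact Oᶜ := hOo.isClosed_compl.isCompact
  have hcl : ∀ k, IsClosed ((F k : Subgroup (absoluteGaloisGroup K)) : Set (absoluteGaloisGroup K)) :=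
    fun k ↦ Subgroup.isClosed_of_isOpen _ (isOpen_ker_modNCyclotomicCharacter p k)
  have hempty : Oᶜ ∩ ⋂ k, ((F k : Subgroup (absoluteGaloisGroup K)) : Set (absoluteGaloisGroup K)) = ∅ := by
    rw [← Subgroup.coe_iInf, Set.eq_empty_iff_forall_notMem]
    rintro x ⟨hx1, hx2⟩
    exact hx1 (hsub hx2)
  have hdir : Directed (· ⊇ ·) fun k ↦ ((F k : Subgroup (absoluteGaloisGroup K)) :
      Set (absoluteGaloisGroup K)) := by
    refine fun i j ↦ ⟨max i j, ?_, ?_⟩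
    · exact fun x hx ↦ ker_modNCyclotomicCharacter_antitone p (le_max_left i j) hx
    · exact fun x hx ↦ ker_modNCyclotomicCharacter_antitone p (le_max_right i j) hx
  obtain ⟨k₀, hk₀⟩ := hcpt.elim_directed_family_closed _ hcl hempty hdir
  refine ⟨k₀, fun k hk x hx ↦ ?_⟩
  have hx' : x ∈ F k₀ := ker_modNCyclotomicCharacter_antitone p hk hx
  by_contra hxO
  exact (Set.eq_empty_iff_forall_notMem.1 hk₀) x ⟨hxO, hx'⟩

/-- **The STAGES eventually lie inside every layer subgroup**: for an open (indeed any) `U₀ ≤ Γ_K`,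
`U₀ ⊓ F_k ≤ κ⁻¹(p^M ℤ_p)` for all large `k` — the hypothesis «`T ≤ κ.layerSubgroup M`» of the
Brauer-killing theorem `exists_forall_resSub_mu_primePow_eq_zero_of_le_layerSubgroup` at the stage
`T = U₀ ⊓ F_k` of «stagesDie». [cite: Washington1997, §13.1] [cite: NeukirchSchmidtWingberg2008, (10.3.25) (proof)] -/
theorem exists_forall_inf_ker_modNCyclotomicCharacter_le_layerSubgroup {κ : ZpExtension K p}
    (hκ : κ.IsCyclotomic) (U₀ : Subgroup (absoluteGaloisGroup K)) (M : ℕ) :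
    ∃ k₀ : ℕ, ∀ k : ℕ, k₀ ≤ k →
      U₀ ⊓ (modNCyclotomicCharacter K (p ^ k)).ker ≤ κ.layerSubgroup M := by
  obtain ⟨k₀, hk₀⟩ := exists_forall_ker_modNCyclotomicCharacter_le_layerSubgroup p hκ M
  exact ⟨k₀, fun k hk ↦ le_trans inf_le_right (hk₀ k hk)⟩

end Levels

/-! ### §2. The coefficient side: `A ≤ D ≃ ℚ_p/ℤ_p` killed by `p^a` embeds in `μ_{p^a}(K̄)`, and
`μ_{p^{a+t}}(K̄) → D` extends the way back -/

section Coefficients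

variable (K : Type) [Field K] [CharZero K] (p : ℕ) [hp : Fact p.Prime]

/-- `ℚ_p/ℤ_p` is divisible: `n • (·)` is onto for `n ≠ 0` (`[q] = n • [q/n]`).
[cite: Hungerford1974, Ch. I §3 Exercise 7 (a), Ch. IV §3 Lemma 3.9] -/
private theorem qpModZp_nsmul_surjective {n : ℕ} (hn : n ≠ 0) :
    Function.Surjective fun x : QpModZp p ↦ n • x := by
  intro x
  induction x using Submodule.Quotient.induction_on with
  | H q =>
    refine ⟨QpModZp.mk p (q / n), ?_⟩
    change n • QpModZp.mk p (q / n) = QpModZp.mk p q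
    rw [← Nat.cast_smul_eq_nsmul ℤ_[p] n, QpModZp.smul_mk, PadicInt.coe_natCast,
      mul_div_cancel₀ q (Nat.cast_ne_zero.mpr hn)]

omit [CharZero K] in
/-- The inclusion `μ_n ↪ μ_m` (`n ∣ m`) of the tree (`muInclusion`) is injective. [folklore] -/
private theorem muInclusion_injective' {n m : ℕ} (h : n ∣ m) :
    Function.Injective (muInclusion K h) := fun v w hvw ↦
  muVal_injective K n (by rw [← muVal_muInclusion K h v, ← muVal_muInclusion K h w, hvw])

/-- **The coefficient side of «stagesDie».**  Let `D ≃+ ℚ_p/ℤ_p` and let `A ≤ D` be a subgroup killed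
by `p^a`.  There is an INJECTIVE additive `e : A → μ_{p^a}(K̄)` (`MuCarrier K (p^a)`) such that for
every `t` some additive `g : μ_{p^{a+t}}(K̄) → D` satisfies `g (ι (e x)) = x` for all `x ∈ A`, `ι` the
inclusion `μ_{p^a} ↪ μ_{p^{a+t}}` (`muInclusion`).  Proof: a Prüfer embedding `j : ℚ_p/ℤ_p ↪ K̄ˣ`
(tree `QpModZp.exists_injective_units`) maps the `p^a`-torsion `A` into `μ_{p^a}(K̄)`; the way back is
Baer's criterion for the divisible group `ℚ_p/ℤ_p` applied along the injection `ι ∘ e`.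
[cite: Hungerford1974, Ch. I §3 Exercise 7, Ch. IV §3 Lemma 3.9 / Prop. 3.13 (divisible ⟹ injective)]
[cite: NeukirchSchmidtWingberg2008, (10.3.25) (proof)] -/
theorem exists_muCarrier_embedding_extension {D : Type} [AddCommGroup D]
    (hD : Nonempty (D ≃+ ℚ_[p] ⧸ (PadicInt.subring p).toAddSubgroup))
    (A : AddSubgroup D) {a : ℕ} (hA : ∀ x ∈ A, p ^ a • x = 0) :
    ∃ e : A →+ MuCarrier K (p ^ a), Function.Injective e ∧
      ∀ t : ℕ, ∃ g : MuCarrier K (p ^ (a + t)) →+ D,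
        ∀ x : A, g (muInclusion K (pow_dvd_pow p (Nat.le_add_right a t)) (e x)) = (x : D) := by
  classical
  obtain ⟨φ⟩ := hD
  let ψ : D ≃+ QpModZp p := φ.trans (QpModZp.addEquivQuotientSubring p).symm
  -- a Prüfer embedding `ℚ_p/ℤ_p ↪ K̄ˣ`
  haveI : NeZero p := ⟨hp.out.ne_zero⟩
  obtain ⟨jμ, hj⟩ := QpModZp.exists_injective_units (p := p) (AlgebraicClosure K)
  let j : D →+ Additive (AlgebraicClosure K)ˣ := jμ.comp ψ.toAddMonoidHom
  have hjinj : Function.Injective j := hj.comp ψ.injective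
  let e₀ : A →+ Additive (AlgebraicClosure K)ˣ := j.comp A.subtype
  have he₀ : Function.Injective e₀ := hjinj.comp Subtype.val_injective
  -- `A` lands in the `p^a`-th roots of unity
  have hroot : ∀ x : A, (Additive.toMul (e₀ x) : (AlgebraicClosure K)ˣ) ^ p ^ a = 1 := fun x ↦ by
    have h1 : e₀ ((p ^ a) • x) = 0 := by
      have hx : (p ^ a) • x = 0 := Subtype.ext (by
        rw [AddSubgroup.coe_nsmul, AddSubgroup.coe_zero]; exact hA x x.2)
      rw [hx, map_zero]
    rw [map_nsmul] at h1
    have h2 := congrArg Additive.toMul h1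
    rwa [toMul_nsmul, toMul_zero] at h2
  let e : A →+ MuCarrier K (p ^ a) :=
    { toFun := fun x ↦ muOfUnit K (p ^ a) (Additive.toMul (e₀ x)) (hroot x)
      map_zero' := muVal_injective K (p ^ a) (by
        rw [muVal_muOfUnit, muVal_zero, map_zero, toMul_zero])
      map_add' := fun x y ↦ muVal_injective K (p ^ a) (by
        rw [muVal_muOfUnit, muVal_add, muVal_muOfUnit, muVal_muOfUnit, map_add, toMul_add]) }
  have he_val : ∀ x : A, muVal K (p ^ a) (e x) = Additive.toMul (e₀ x) := fun x ↦ rfl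
  have he : Function.Injective e := fun x y hxy ↦
    he₀ (Additive.toMul.injective (by rw [← he_val, ← he_val, hxy]))
  refine ⟨e, he, fun t ↦ ?_⟩
  -- Baer: extend `ψ ∘ (A ↪ D)` along the injection `ι ∘ e : A ↪ μ_{p^{a+t}}`
  haveI : DivisibleBy (QpModZp p) ℕ :=
    divisibleByOfSMulRightSurj (QpModZp p) ℕ fun {n} hn ↦ qpModZp_nsmul_surjective p hn
  haveI : DivisibleBy (QpModZp p) ℤ := AddGroup.divisibleByIntOfDivisibleByNat (QpModZp p)
  have hdvd : p ^ a ∣ p ^ (a + t) := pow_dvd_pow p (Nat.le_add_right a t)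
  let ι : MuCarrier K (p ^ a) →+ MuCarrier K (p ^ (a + t)) := muInclusion K hdvd
  have hι : Function.Injective (ι.comp e) := (muInclusion_injective' K hdvd).comp he
  obtain ⟨h, hh⟩ := (Module.Baer.of_divisible (QpModZp p)).extension_property_addMonoidHom
    (ι.comp e) hι (ψ.toAddMonoidHom.comp A.subtype)
  refine ⟨ψ.symm.toAddMonoidHom.comp h, fun x ↦ ?_⟩
  have hx := DFunLike.congr_fun hh x
  simp only [AddMonoidHom.comp_apply] at hx
  change ψ.symm (h (ι (e x))) = (x : D)
  rw [hx]
  exact ψ.symm_apply_apply _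

end Coefficients

end Literature.NumberTheory.IwasawaTheory

end
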